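import Summits.QuantumAdvantage.AdviceFreeQNC0.AffBells23AntipodalSmall
import HarnessLib

/-!
# (NP₀) is FALSE at `N = 7`: a PERFECT affine MOD₃ bell strategy on the 7-cycle, kernel-certified — so `n₀ ≥ 8` in
# `AffBells23.NoPerfectAffineBells3`

qn-lit g26's second lineage (kit j305375, kissat MODEL #1; INBOX 2026-08-28T10:32Z) and qn-p1 g24's third lineage (j305966) found
perfect affine MOD₃ bell strategies `z_k(x) = [⟨β_k, x⟩ ≡ c_k (3)]` for the ring relation on the ODD class of the 7-cycle.  This file
(prover seat qn-prover-3 g13) certifies MODEL #1 IN THE KERNEL (standard axioms; `decide +kernel` over the `Fin.cons` enumerators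
`allCoins`/`relB` of `AffBells23AntipodalSmall.lean`): rows (trit strings over positions `0..6`, all offsets `c_k = 0`)
`β₀ = β₂ = β₃ = 0000000` (constant bells `z ≡ 1`), `β₁ = 2221122` (`z₁ = [2|x| ≡ x₃ + x₄]`, full support), `β₄ = 1020110`,
`β₅ = 2000010` (`z₅ = [x₀ = x₅]`), `β₆ = 2000012`.

* `perfect_seven` — every odd input of the 7-cycle satisfies `RingHLF.Rel x (affBell sevenRows 0 x)`;
* `noPerfectAffineBells3_threshold` — any threshold `n₀` witnessing `NoPerfectAffineBells3` is `≥ 8`.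

WHAT THIS IS NOT: nothing about `N ≥ 8` (kissat/cadical UNKNOWN at 3 h, qn-lit j306108); the shape (three constant rows + ONE dense row
`|x| mod 3` + sparse rows) is "frame ⊗ junta", consistent with (NP); instrument for crux stmt-QuantumAdvantage-22907; separation NOT moved.
-/

namespace Summit.QuantumAdvantage.AdviceFreeQNC0

namespace AffBells23

open Finset Literature.Computability.QuantumComplexity

/-- MODEL #1 of kit j305375 (qn-lit g26): the row system `β` of a perfect affine MOD₃ bell strategy on the 7-cycle (all `c_k = 0`). -/
def sevenRows : Fin 7 → Fin 7 → ZMod 3 :=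
  ![![0, 0, 0, 0, 0, 0, 0], ![2, 2, 2, 1, 1, 2, 2], ![0, 0, 0, 0, 0, 0, 0], ![0, 0, 0, 0, 0, 0, 0],
    ![1, 0, 2, 0, 1, 1, 0], ![2, 0, 0, 0, 0, 1, 0], ![2, 0, 0, 0, 0, 1, 2]]

/-- Kernel evaluation: on every input with an odd number of zeros the strategy satisfies the ring relation. -/
private theorem perfect_seven_eval :
    allCoins 7 (fun x => !decide ((univ.filter fun b : Fin 7 => x b = false).card % 2 = 1) ||
      relB x (affBell sevenRows (fun _ => (0 : ZMod 3)) x)) = true := by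
  decide +kernel

/-- **(NP₀) fails at `N = 7`**: MODEL #1 is PERFECT — every odd input of the 7-cycle is won. -/
theorem perfect_seven (x : Fin 7 → Bool) (hx : OddZeros x) :
    RingHLF.Rel x (affBell sevenRows (fun _ => (0 : ZMod 3)) x) := by
  have h := (allCoins_eq_true_iff 7 _).1 perfect_seven_eval x
  rw [Bool.or_eq_true, Bool.not_eq_true', decide_eq_false_iff_not, relB_eq_true_iff] at h
  exact h.resolve_left (fun h' => h' hx)

/-- **`n₀ ≥ 8` in `NoPerfectAffineBells3`**: no threshold `n₀ ≤ 7` works. -/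
theorem noPerfectAffineBells3_threshold (n₀ : ℕ)
    (h : ∀ N ≥ n₀, ∀ (β : Fin N → Fin N → ZMod 3) (c : Fin N → ZMod 3),
      ∃ x : Fin N → Bool, OddZeros x ∧ ¬ RingHLF.Rel x (affBell β c x)) : 8 ≤ n₀ := by
  by_contra hlt
  push Not at hlt
  obtain ⟨x, hx, hrel⟩ := h 7 (by omega) sevenRows (fun _ => 0)
  exact hrel (perfect_seven x hx)

end AffBells23

end Summit.QuantumAdvantage.AdviceFreeQNC0
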